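import Summits.CriticalPhenomena.PercolationContinuityZ3.Theorems.PercNearOneGluingNoHeavyQuantCrossingWindowOneArm
import Summits.CriticalPhenomena.PercolationContinuityZ3.Theorems.PercAnnulusCrossingCorrelationLengthRate
import Summits.CriticalPhenomena.PercolationContinuityZ3.Theorems.PercNearOneGluingNoHeavyQuantOneArm
import Summits.CriticalPhenomena.PercolationContinuityZ3.Theorems.PercNearOneGluingNoHeavyQuantKnScaleDefect
import HarnessLib

/-!
# The correlation-length reading of the one-arm window: `(p_c − p)²·(ξ log ξ)^d·θ_ξ(p_c) ≳ 1` ("`ν ≥ 2/(d − η₁)`",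
# Dewan–Muirhead's `η̄₁ ≤ d − 2/ν` in kernel form), the (T1) dictionary, and the explicit log* window

builds on p205010 (kernel theorem, internal audit signed; external expert review pending) — used ONLY in §5, and there only
through the lane's effective re-proof (`Quant.oneArm_explicit_rate_criticalProbI`); §4 does not use it.

QUANT lane (`prim-quant`), seat p4 (METHOD: differential inequalities for `θ` near `p_c`), gen 14; helper file
`--supports stmt-CriticalPhenomena-4575`; pure proofs, no definitions, no sorries.  Companion of `…QuantCrossingWindowOneArm.lean`
(the one-arm window `u_p(L,4L) < 85^{−d}/4 ⟹ 85^{−d}p(1−p_c) < (p_c−p)²·16d(8L+1)^d·θ_L(p_c)`), which is here evaluated at the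
scale `L = ⌈A_d ξ⁺ log(2ξ⁺+1)⌉ + 2` of lane 3's `Crossing.decay_at_scale` (the subcritical crossing has decayed there):

* §4 `sq_mul_oneArm_gt_of_decay` (workhorse); **`exists_mul_le_sq_mul_pow_corrLength_oneArm`** (`d ≥ 2`): `∃ c_d > 0`, for every
  `0 < p < p_c(ℤ^d)`, **`c_d·p ≤ (p_c − p)²·(ξ⁺ log(2ξ⁺+1))^d·θ_{⌈ξ⁺⌉}(p_c)`**, `ξ⁺ = max(1, percCorrLength d p)` — lane 3's
  `Crossing.exists_mul_le_sq_mul_pow_corrLength` ("`ν ≥ 2/d`", Duminil-Copin–Kozma–Tassion 2020 §8) multiplied by the critical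
  one-arm probability at radius `⌈ξ⁺⌉`; dictionary **`sq_mul_rpow_corrLength_ge_of_oneArmDecay`**:
  `Quant.OneArmPolyDecayAtCritical d c₁ C₁ ⟹ c_d p ≤ C₁(p_c − p)²(ξ⁺)^{d−c₁}(log(2ξ⁺+1))^d` ("`ν ≥ 2/(d − c₁)`" up to a logarithm;
  the hypothesis is OPEN for `3 ≤ d ≤ 6`; mean field `c₁ = 2`: `2/(d−2) = 1/2` exactly at `d = 6`).
* §5 `le_real_boxCrossing_of_window_logStar` (`d ≥ 3`): the window with `θ_L(p_c)` replaced by the lane's explicit bound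
  `(1 − knEta d)^{iterCount (knLHi d) L}` (V35) — an explicit function of iterated-logarithm type and nothing more.

In print: V. Dewan, S. Muirhead, PTRF (2022), Thm. 1.10 (`η̄₁ ≤ d − 2/ν`, assuming the exponents exist) and its proof, p. 10
("`(p_c − p')² R^d P_{p_c}[A_1(R)] ≥ c` for large `R`", `R = Cξ(p')log ξ(p')`).  Honest: kernel finite forms; no rate for `d = 3`.
-/

noncomputable section

namespace Summit.CriticalPhenomena.PercolationContinuityZ3.Theorems.CrossingRevealment

open MeasureTheory Finset Function Set Filter Topology
open Literature.Probability.Percolation Literature.Probability.LatticeModels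
open Literature.Probability.Percolation.DCT16
open Summit.CriticalPhenomena.PercolationContinuityZ3.Theorems.SurfaceTension
open Summit.CriticalPhenomena.PercolationContinuityZ3.Theorems.Crossing

variable {d : ℕ}

/-! ### §4. The correlation-length reading: `(p_c − p)²·(ξ log ξ)^d·θ_ξ(p_c) ≳ 1` ("`ν ≥ 2/(d − η₁)`") -/

/-- The workhorse (lane 3's `Crossing.sq_mul_pow_gt_of_decay` with the one-arm window): for `d ≥ 2`, `0 < p < p_c`, `L ≥ 1`,
if the one-arm rate `φ(p) = 1/ξ(p)` satisfies `φ(p)·(3L − 1) > d·log(2L+1) + log(8d) + d·log 85` then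
`85^{−d}·p·(1 − p_c) < (p_c − p)² · 16d(8L+1)^d · θ_L(p_c)`.
[cite: DewanMuirhead2022, §2 proof of Thm. 1.10 (R = Cξ(p')log ξ(p'), (p_c − p')²R^dP_{p_c}[A_1(R)] ≥ c)] -/
theorem sq_mul_oneArm_gt_of_decay (hd : 2 ≤ d) (p : unitInterval) (hp0 : 0 < (p : ℝ))
    (hpc : (p : ℝ) < criticalProb (zdGraph d) 0) {L : ℕ} (hL : 1 ≤ L)
    (hdecay : d * Real.log (2 * L + 1) + Real.log (8 * d) + d * Real.log 85 <
      (RSW3.subadditive_oneArm (d := d) (by omega) p hp0).lim * ((3 * L - 1 : ℕ) : ℝ)) :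
    ((85 : ℝ) ^ d)⁻¹ * p * (1 - criticalProbI d) <
      ((criticalProbI d : ℝ) - p) ^ 2 * (16 * d * (8 * (L : ℝ) + 1) ^ d
        * (bondPercolation (zdGraph d) (criticalProbI d)).real (siteToBoundary d L)) := by
  have hd0 : 0 < d := by omega
  set φ := (RSW3.subadditive_oneArm (d := d) hd0 p hp0).lim with hφ
  set m : ℕ := 3 * L - 1 with hm
  -- the envelope: `u ≤ (2L+1)^d · 2d · e^{-φ m}` (lane 3)
  have hLN : L < 4 * L := by omega
  have h1 := Rsw3.real_boxCrossing_le_card_mul_oneArmProb (d := d) p hLN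
  have hsub : 4 * L - L - 1 = m := by omega
  rw [hsub] at h1
  have h2 := RSW3.oneArmProb_le_mul_exp_neg hd0 p hp0 m
  have hu : (bondPercolation (zdGraph d) p).real (boxCrossing d L (4 * L)) ≤
      (2 * (L : ℝ) + 1) ^ d * (2 * d * Real.exp (-φ * m)) :=
    h1.trans (mul_le_mul_of_nonneg_left h2 (by positivity))
  have h2L : (0 : ℝ) < 2 * L + 1 := by positivity
  have hE : (2 * (L : ℝ) + 1) ^ d * (8 * d) * (85 : ℝ) ^ d < Real.exp (φ * m) := by
    have h := Real.exp_lt_exp.2 hdecay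
    rw [Real.exp_add, Real.exp_add, Real.exp_nat_mul, Real.exp_nat_mul, Real.exp_log h2L,
      Real.exp_log (by positivity), Real.exp_log (by norm_num)] at h
    exact h
  have hexp : 0 < Real.exp (φ * m) := Real.exp_pos _
  have hlt : (2 * (L : ℝ) + 1) ^ d * (2 * d * Real.exp (-φ * m)) < ((85 : ℝ) ^ d)⁻¹ / 4 := by
    rw [show -φ * (m : ℝ) = -(φ * m) by ring, Real.exp_neg]
    rw [show (2 * (L : ℝ) + 1) ^ d * (2 * d * (Real.exp (φ * m))⁻¹) =
        ((2 * (L : ℝ) + 1) ^ d * (8 * d) * (85 : ℝ) ^ d / Real.exp (φ * m)) * (((85 : ℝ) ^ d)⁻¹ / 4) by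
      field_simp; ring]
    calc (2 * (L : ℝ) + 1) ^ d * (8 * d) * (85 : ℝ) ^ d / Real.exp (φ * m) * (((85 : ℝ) ^ d)⁻¹ / 4)
        < 1 * (((85 : ℝ) ^ d)⁻¹ / 4) := by
          refine mul_lt_mul_of_pos_right ?_ (by positivity)
          rwa [div_lt_one hexp]
      _ = ((85 : ℝ) ^ d)⁻¹ / 4 := one_mul _
  have hpc' : (p : ℝ) ≤ criticalProbI d := by rw [coe_criticalProbI]; exact hpc.le
  exact sq_mul_oneArm_gt_of_real_boxCrossing_lt hd p hp0 hpc' hL (hu.trans_lt hlt)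

/-- **THE CORRELATION-LENGTH RATE, ONE-ARM FORM** (`d ≥ 2`; no use of p205010): there is `c_d > 0` such that for every
`0 < p < p_c(ℤ^d)`, with `ξ⁺ = max(1, ξ(p))` (`ξ = percCorrLength`, `= 1/φ(p)` below `p_c`) and `ℓ = log(2ξ⁺ + 1)`,
**`c_d · p ≤ (p_c − p)² · (ξ⁺ℓ)^d · θ_{⌈ξ⁺⌉}(p_c)`**.  Lane 3's `Crossing.exists_mul_le_sq_mul_pow_corrLength` is the same without
the factor `θ_{⌈ξ⁺⌉}(p_c)` ("`ν ≥ 2/d`"); with it the statement reads "`ν ≥ 2/(d − η₁)`" (Dewan–Muirhead's `η̄₁ ≤ d − 2/ν`) in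
finite form: the scale is `L = ⌈A_d ξ⁺ ℓ⌉ + 2 ≥ ⌈ξ⁺⌉` (`Crossing.decay_at_scale`) and `θ_L ≤ θ_{⌈ξ⁺⌉}`.
[cite: DewanMuirhead2022, Thm. 1.10 (η̄₁ ≤ d − 2/ν) and its proof §2 p. 10] -/
theorem exists_mul_le_sq_mul_pow_corrLength_oneArm (hd : 2 ≤ d) :
    ∃ c : ℝ, 0 < c ∧ ∀ p : unitInterval, 0 < (p : ℝ) → (p : ℝ) < criticalProb (zdGraph d) 0 →
      c * p ≤ ((criticalProbI d : ℝ) - p) ^ 2 *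
        (max 1 (percCorrLength d p) * Real.log (2 * max 1 (percCorrLength d p) + 1)) ^ d *
        (bondPercolation (zdGraph d) (criticalProbI d)).real (siteToBoundary d ⌈max 1 (percCorrLength d p)⌉₊) := by
  have hd1 : 1 ≤ d := by omega
  have hd0 : 0 < d := by omega
  have hd' : (0 : ℝ) < d := by exact_mod_cast hd0
  have hpc1 : (criticalProbI d : ℝ) < 1 := by rw [coe_criticalProbI]; exact criticalProb_zd_lt_one hd
  obtain ⟨A, hA2, hA⟩ := exists_decay_const (d := d) hd1
  have hA0 : 0 < A := by linarith
  have hd1' : (1 : ℝ) ≤ d := by exact_mod_cast hd1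
  have hA1 : 1 ≤ A := by nlinarith
  set c : ℝ := ((85 : ℝ) ^ d)⁻¹ * (1 - criticalProbI d) / (16 * d * (8 * A + 25) ^ d) with hc
  refine ⟨c, by rw [hc]; positivity, fun p hp0 hpc => ?_⟩
  -- the correlation length and the one-arm rate
  set φ := (RSW3.subadditive_oneArm (d := d) hd0 p hp0).lim with hφ
  have hφ0 : 0 < φ := RSW3.lim_oneArm_pos_of_lt_criticalProb hd p hp0 hpc
  have hξφ : percCorrLength d p = φ⁻¹ := Rsw3.percCorrLength_eq_inv_lim_oneArm hd1 p hp0 hpc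
  set ξ : ℝ := max 1 (percCorrLength d p) with hξ
  have hξ1 : 1 ≤ ξ := le_max_left _ _
  have hφξ : 1 ≤ φ * ξ := by
    have h1 : φ * φ⁻¹ = 1 := mul_inv_cancel₀ hφ0.ne'
    have h2 : φ * φ⁻¹ ≤ φ * ξ := mul_le_mul_of_nonneg_left (by rw [hξ, hξφ]; exact le_max_right _ _) hφ0.le
    linarith
  set ℓ := Real.log (2 * ξ + 1) with hℓ
  have h3 : (1 : ℝ) < Real.log 3 := by
    rw [Real.lt_log_iff_exp_lt (by norm_num)]; exact Real.exp_one_lt_three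
  have hℓ1 : 1 < ℓ := h3.trans_le (Real.log_le_log (by norm_num) (by linarith))
  have hx0 : 0 ≤ A * ξ * ℓ := by positivity
  have hx1 : 1 ≤ ξ * ℓ := by nlinarith
  -- the scale
  set L : ℕ := ⌈A * ξ * ℓ⌉₊ + 2 with hL
  have hL1 : 1 ≤ L := by rw [hL]; omega
  have hLhi : (L : ℝ) < A * ξ * ℓ + 3 := by
    rw [hL]; push_cast; linarith [Nat.ceil_lt_add_one hx0]
  have hdecay := decay_at_scale (d := d) hd1 hA2 hA hξ1 hφ0 hφξ
  have hmain := sq_mul_oneArm_gt_of_decay hd p hp0 hpc hL1 hdecay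
  -- `θ_L(p_c) ≤ θ_{⌈ξ⌉}(p_c)` since `⌈ξ⌉ ≤ L`
  set θξ : ℝ := (bondPercolation (zdGraph d) (criticalProbI d)).real (siteToBoundary d ⌈ξ⌉₊) with hθξ
  have hθξ0 : 0 ≤ θξ := measureReal_nonneg
  have hceil : ⌈ξ⌉₊ ≤ L := by
    have h1 : ξ ≤ A * ξ * ℓ := by nlinarith
    have h2 : ⌈ξ⌉₊ ≤ ⌈A * ξ * ℓ⌉₊ := Nat.ceil_mono h1
    rw [hL]; omega
  have hθL : (bondPercolation (zdGraph d) (criticalProbI d)).real (siteToBoundary d L) ≤ θξ :=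
    real_siteToBoundary_antitone _ hceil
  -- `(8L+1)^d ≤ (8A+25)^d (ξℓ)^d`
  have h8L : 8 * (L : ℝ) + 1 ≤ (8 * A + 25) * (ξ * ℓ) := by nlinarith
  have hpow : (8 * (L : ℝ) + 1) ^ d ≤ (8 * A + 25) ^ d * (ξ * ℓ) ^ d := by
    rw [← mul_pow]; exact pow_le_pow_left₀ (by positivity) h8L d
  have hδ : 0 ≤ ((criticalProbI d : ℝ) - p) ^ 2 := sq_nonneg _
  have hfin : ((85 : ℝ) ^ d)⁻¹ * p * (1 - criticalProbI d) <
      ((criticalProbI d : ℝ) - p) ^ 2 * (16 * d * ((8 * A + 25) ^ d * (ξ * ℓ) ^ d) * θξ) := by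
    refine hmain.trans_le (mul_le_mul_of_nonneg_left ?_ hδ)
    exact mul_le_mul (mul_le_mul_of_nonneg_left hpow (by positivity)) hθL measureReal_nonneg (by positivity)
  -- divide by `16d(8A+25)^d`
  have hD : 0 < 16 * (d : ℝ) * (8 * A + 25) ^ d := by positivity
  rw [hc, div_mul_eq_mul_div, div_le_iff₀ hD]
  calc ((85 : ℝ) ^ d)⁻¹ * (1 - criticalProbI d) * p = ((85 : ℝ) ^ d)⁻¹ * p * (1 - criticalProbI d) := by ring
    _ ≤ ((criticalProbI d : ℝ) - p) ^ 2 * (16 * d * ((8 * A + 25) ^ d * (ξ * ℓ) ^ d) * θξ) := hfin.le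
    _ = ((criticalProbI d : ℝ) - p) ^ 2 * (ξ * ℓ) ^ d * θξ * (16 * d * (8 * A + 25) ^ d) := by ring

/-- **DICTIONARY ((T1) ⟹ "`ν ≥ 2/(d − c)`")**: if `π_{p_c}(n) ≤ C₁ n^{−c₁}` for all `n ≥ 1` (`Quant.OneArmPolyDecayAtCritical d c₁ C₁`,
`c₁ ≥ 0`), then for every `0 < p < p_c(ℤ^d)`: `c_d · p ≤ C₁ · (p_c − p)² · (ξ⁺)^{d − c₁} · (log(2ξ⁺+1))^d` with the `c_d > 0`
of `exists_mul_le_sq_mul_pow_corrLength_oneArm` — the correlation length diverges at least like `(p_c − p)^{−2/(d − c₁)}` up to a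
logarithm (the hypothesis is open for `3 ≤ d ≤ 6`; mean field `c₁ = 2` gives `2/(d−2)`, i.e. `ν ≥ 1/2` exactly at `d = 6`).
[cite: DewanMuirhead2022, Thm. 1.10 (η̄₁ ≤ d − 2/ν)] -/
theorem sq_mul_rpow_corrLength_ge_of_oneArmDecay (hd : 2 ≤ d) {c₁ C₁ : ℝ} (hc₁ : 0 ≤ c₁)
    (hdec : Quant.OneArmPolyDecayAtCritical d c₁ C₁) :
    ∃ c : ℝ, 0 < c ∧ ∀ p : unitInterval, 0 < (p : ℝ) → (p : ℝ) < criticalProb (zdGraph d) 0 →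
      c * p ≤ C₁ * ((criticalProbI d : ℝ) - p) ^ 2 *
        (max 1 (percCorrLength d p)) ^ ((d : ℝ) - c₁) * Real.log (2 * max 1 (percCorrLength d p) + 1) ^ d := by
  obtain ⟨c, hc, hmain⟩ := exists_mul_le_sq_mul_pow_corrLength_oneArm (d := d) hd
  refine ⟨c, hc, fun p hp0 hpc => ?_⟩
  have h := hmain p hp0 hpc
  set ξ : ℝ := max 1 (percCorrLength d p) with hξ
  set ℓ : ℝ := Real.log (2 * ξ + 1) with hℓ
  have hξ1 : 1 ≤ ξ := le_max_left _ _
  have hξ0 : 0 < ξ := by linarith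
  have hℓ0 : 0 ≤ ℓ := Real.log_nonneg (by linarith)
  -- `θ_{⌈ξ⌉}(p_c) ≤ C₁ ⌈ξ⌉^{−c₁} ≤ C₁ ξ^{−c₁}`
  have hceil1 : 1 ≤ ⌈ξ⌉₊ := Nat.one_le_iff_ne_zero.2 (by
    intro h0; have := Nat.ceil_eq_zero.1 h0; linarith)
  have hθ : (bondPercolation (zdGraph d) (criticalProbI d)).real (siteToBoundary d ⌈ξ⌉₊) ≤ C₁ * ξ ^ (-c₁) := by
    refine (hdec ⌈ξ⌉₊ hceil1).trans ?_
    have hC₁ : 0 ≤ C₁ := by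
      have h1 := hdec 1 le_rfl
      simp only [Nat.cast_one, Real.one_rpow, mul_one] at h1
      exact measureReal_nonneg.trans h1
    refine mul_le_mul_of_nonneg_left ?_ hC₁
    exact Real.rpow_le_rpow_of_nonpos hξ0 (Nat.le_ceil ξ) (by linarith)
  have hδ : 0 ≤ ((criticalProbI d : ℝ) - p) ^ 2 := sq_nonneg _
  have hξℓ : 0 ≤ (ξ * ℓ) ^ d := by positivity
  calc c * p ≤ ((criticalProbI d : ℝ) - p) ^ 2 * (ξ * ℓ) ^ d *
        (bondPercolation (zdGraph d) (criticalProbI d)).real (siteToBoundary d ⌈ξ⌉₊) := h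
    _ ≤ ((criticalProbI d : ℝ) - p) ^ 2 * (ξ * ℓ) ^ d * (C₁ * ξ ^ (-c₁)) :=
        mul_le_mul_of_nonneg_left hθ (mul_nonneg hδ hξℓ)
    _ = C₁ * ((criticalProbI d : ℝ) - p) ^ 2 * ξ ^ ((d : ℝ) - c₁) * ℓ ^ d := by
        rw [mul_pow, show ((d : ℝ) - c₁) = (d : ℝ) + (-c₁) by ring, Real.rpow_add hξ0, Real.rpow_natCast]
        ring

/-- **`ℤ³` instance**: `∃ c > 0`, for every `0 < p < p_c(ℤ³)`, `c·p ≤ (p_c − p)²·(ξ⁺ log(2ξ⁺+1))³·θ_{⌈ξ⁺⌉}(p_c)` — lane 3's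
`ξ log ξ ≳ (p_c − p)^{−2/3}` sharpened by the critical one-arm probability at radius `⌈ξ⁺⌉` (conjecturally `θ_n(p_c) ≈ n^{−0.48}` and
`ν ≈ 0.88` on `ℤ³`; orientation only). [cite: DewanMuirhead2022, Thm. 1.10 (η̄₁ ≤ d − 2/ν)] -/
theorem exists_mul_le_sq_mul_pow_corrLength_oneArm_three :
    ∃ c : ℝ, 0 < c ∧ ∀ p : unitInterval, 0 < (p : ℝ) → (p : ℝ) < criticalProb (zdGraph 3) 0 →
      c * p ≤ ((criticalProbI 3 : ℝ) - p) ^ 2 *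
        (max 1 (percCorrLength 3 p) * Real.log (2 * max 1 (percCorrLength 3 p) + 1)) ^ 3 *
        (bondPercolation (zdGraph 3) (criticalProbI 3)).real (siteToBoundary 3 ⌈max 1 (percCorrLength 3 p)⌉₊) :=
  exists_mul_le_sq_mul_pow_corrLength_oneArm (d := 3) (by norm_num)

/-! ### §5. The explicit form: the lane's iterated-logarithm one-arm rate at `p_c` (d ≥ 3) -/

/-- **Explicit one-arm window** (`d ≥ 3`, `0 < p ≤ p_c`, `L ≥ 1`): if
`(p_c − p)²·16d(8L+1)^d·(1 − knEta d)^{iterCount (knLHi d) L} ≤ 85^{−d}·p·(1 − p_c)` then `u_p(L,4L) ≥ 85^{−d}/4` — §2 with the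
lane's explicit critical one-arm rate `θ_L(p_c) ≤ (1 − knEta d)^{iterCount (knLHi d) L}` (`Quant.oneArm_explicit_rate_criticalProbI`;
`d = 3`: base `≥ 1 − 2^{−12567}`, count `≍ log*₂ L / 2`).  Every symbol is a closed-form kernel term; the improvement over the CCFS
window is the explicit factor `8(1 − knEta d)^{iterCount (knLHi d) L} → 0`, of iterated-logarithm type and nothing more.
builds on p205010 (kernel theorem, internal audit signed; external expert review pending) only through its effective
re-proof (`Quant.knScaleDefect_criticalProbI`: additive gluing + BGN + DKT Prop. 1). -/
theorem le_real_boxCrossing_of_window_logStar (hd : 3 ≤ d) (p : unitInterval) (hp0 : 0 < (p : ℝ))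
    (hpc : (p : ℝ) ≤ criticalProbI d) {L : ℕ} (hL : 1 ≤ L)
    (hwin : ((criticalProbI d : ℝ) - p) ^ 2 * (16 * d * (8 * (L : ℝ) + 1) ^ d
        * (1 - Quant.knEta d) ^ Quant.iterCount (Quant.knLHi d) L) ≤
      ((85 : ℝ) ^ d)⁻¹ * p * (1 - criticalProbI d)) :
    ((85 : ℝ) ^ d)⁻¹ / 4 ≤ (bondPercolation (zdGraph d) p).real (boxCrossing d L (4 * L)) := by
  haveI : NeZero d := ⟨by omega⟩
  have hθ : (bondPercolation (zdGraph d) (criticalProbI d)).real (siteToBoundary d L)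
      ≤ (1 - Quant.knEta d) ^ Quant.iterCount (Quant.knLHi d) L :=
    Quant.oneArm_explicit_rate_criticalProbI hd L
  refine le_real_boxCrossing_of_window_oneArm (by omega) p hp0 hpc hL (le_trans ?_ hwin)
  refine mul_le_mul_of_nonneg_left (mul_le_mul_of_nonneg_left hθ (by positivity)) (sq_nonneg _)

end Summit.CriticalPhenomena.PercolationContinuityZ3.Theorems.CrossingRevealment

end
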